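import Literature.NumberTheory.LFunctions.XiGaussWeight
import Mathlib.Analysis.Complex.ExponentialBounds
import HarnessLib

/-!
# The mode map `a ↦ y(a) = aL(a) - n` of the Gauss-tilted Pólya–de Bruijn weight and its inverse

For the Gauss-tilted weight `ω_{n,x}(u) = Φ(u) uⁿ e^{xu²/2}` (`XiGaussWeight.lean`) the mode `a` of the law
`∝ ω_{n,x}` is characterised by `x = x(a) := y(a)/a²`, `y(a) := aL(a) - n`, `L = -Φ′/Φ`
(`xiGaussPotentialDeriv_mode`). This file inverts that parametrisation:

* `y` is continuous and monotone on `(0, ∞)` and is pinched between the tree's envelopes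
  `a(4πe^{4a} - 9.005) - n ≤ y(a) ≤ a(4πe^{4a} - 9) - n` (Coffey–Csordas);
* **a mode for every admissible `y`** (`exists_xiGauss_mode`): for `d ≥ 1`, `n ≥ 10^{2d+5}` and
  `0 < y ≤ 2n` there is `a ∈ [d+1, n^{1/4} - 1]` with `y(a) = y` — intermediate value theorem between
  `y(d+1) < 0` (from `4π(d+1)e^{4(d+1)} ≤ 10^{2d+5} ≤ n`) and `y(¼ log n) ≥ 2n`;
* `x(a) = L(a)/a - n/a²` is strictly increasing on `[1, ∞)` (`xiGaussX_strictMonoOn`), because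
  `(L/a)′ = (aV - L)/a² > 0` by `V > 16πe^{4a}` (Coffey–Csordas' quantitative log-concavity of `Φ`, tree).

Used by `JensenXiExponentialRange.lean` (mode matching `√x_j · a_j = t_j*` of the Laguerre test points).

## References
* [GORZPNAS2019] Griffin–Ono–Rolen–Zagier, PNAS 116 (2019), Thm. 7 (the tilted kernel `u^kΦ(u)` and its
  maximum).
* [CoffeyCsordas2013] Coffey–Csordas, Math. Comp. 82 (2013), Thm. 2.4, Prop. 2.1.
-/

noncomputable section

open Real Set

namespace Literature.NumberTheory.LFunctions

/-! ### Two numerical constants -/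

/-- `e⁴ ≤ 55`. [folklore] -/
private theorem exp_four_le : Real.exp 4 ≤ 55 := by
  have h := Real.exp_one_lt_d9
  have e : Real.exp 4 = Real.exp 1 ^ 4 := by rw [← Real.exp_nat_mul]; norm_num
  rw [e]
  have : Real.exp 1 ^ 4 ≤ 2.7182818286 ^ 4 :=
    pow_le_pow_left₀ (Real.exp_pos 1).le h.le 4
  linarith [show (2.7182818286 : ℝ) ^ 4 ≤ 55 by norm_num]

/-- `2 ≤ log 10` (`e² ≤ 7.4 < 10`). [folklore] -/
private theorem two_le_log_ten : (2 : ℝ) ≤ Real.log 10 := by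
  rw [Real.le_log_iff_exp_le (by norm_num)]
  have h := Real.exp_one_lt_d9
  have e : Real.exp 2 = Real.exp 1 ^ 2 := by rw [← Real.exp_nat_mul]; norm_num
  rw [e]; nlinarith [Real.exp_pos (1 : ℝ)]

/-! ### The map `a ↦ y(a) = aL(a) - n` and the mode for a prescribed `y` -/

/-- `a ↦ y(a) = aL(a) - n` is continuous. [cite: CoffeyCsordas2013, §1 (p. 2265)] -/
theorem continuous_xiGaussY (n : ℕ) : Continuous (xiGaussY n) :=
  (continuous_id.mul continuous_phiNegLogDeriv).sub continuous_const

/-- `a ↦ y(a)` is monotone on `(0, ∞)` (`L > 0` increasing). [cite: CoffeyCsordas2013, Theorem 2.4] -/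
theorem xiGaussY_mono (n : ℕ) {a b : ℝ} (ha : 0 < a) (hab : a ≤ b) : xiGaussY n a ≤ xiGaussY n b := by
  unfold xiGaussY
  have h1 : phiNegLogDeriv a ≤ phiNegLogDeriv b := strictMono_phiNegLogDeriv.monotone hab
  have h2 : 0 < phiNegLogDeriv a := phiNegLogDeriv_pos ha
  nlinarith [mul_le_mul hab h1 h2.le (by linarith : (0 : ℝ) ≤ b)]

/-- Upper envelope: `y(a) ≤ a(4πe^{4a} - 9) - n` for `a > 0`. [cite: CoffeyCsordas2013, Proposition 2.1] -/
theorem xiGaussY_le (n : ℕ) {a : ℝ} (ha : 0 < a) :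
    xiGaussY n a ≤ a * (4 * π * Real.exp (4 * a) - 9) - n := by
  unfold xiGaussY phiNegLogDeriv
  have h := neg_deBruijnPhiDeriv_div_le ha.le
  nlinarith

/-- Lower envelope: `a(4πe^{4a} - 9.005) - n ≤ y(a)` for `a ≥ 3/2`. [cite: CoffeyCsordas2013, Proposition 2.1] -/
theorem le_xiGaussY (n : ℕ) {a : ℝ} (ha : 3 / 2 ≤ a) :
    a * (4 * π * Real.exp (4 * a) - 9.005) - n ≤ xiGaussY n a := by
  unfold xiGaussY phiNegLogDeriv
  have h := le_neg_deBruijnPhiDeriv_div ha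
  nlinarith

/-- **A mode for every admissible `y`**: for `d ≥ 1`, `10^{2d+5} ≤ n` and `0 < y ≤ 2n` there is
`a ∈ [d+1, n^{1/4} - 1]` with `y(a) = y` (intermediate value theorem between `y(d+1) < 0` — from
`4π(d+1)e^{4(d+1)} ≤ n` — and `y(log n^{1/4}) ≥ 2n`). [cite: GORZPNAS2019, Thm. 7] -/
theorem exists_xiGauss_mode {n d : ℕ} (hd : 1 ≤ d) (hn : (10 : ℝ) ^ (2 * d + 5) ≤ n) {y : ℝ}
    (hy0 : 0 < y) (hy : y ≤ 2 * n) :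
    ∃ a : ℝ, (d : ℝ) + 1 ≤ a ∧ a ≤ Real.sqrt (Real.sqrt n) - 1 ∧ xiGaussY n a = y := by
  have hd' : (1 : ℝ) ≤ d := by exact_mod_cast hd
  have hn1 : (1 : ℝ) ≤ n := le_trans (one_le_pow₀ (by norm_num)) hn
  have hnpos : (0 : ℝ) < n := lt_of_lt_of_le one_pos hn1
  set s := Real.sqrt (Real.sqrt (n : ℝ)) with hs
  have hs0 : 0 < s := Real.sqrt_pos.2 (Real.sqrt_pos.2 hnpos)
  have hs4 : s ^ 4 = n := by
    rw [show (4 : ℕ) = 2 * 2 from rfl, pow_mul, hs, Real.sq_sqrt (Real.sqrt_nonneg _),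
      Real.sq_sqrt hnpos.le]
  -- the upper end `a₁ = log s`, `e^{4a₁} = n`, `a₁ ≥ d + 5/2`
  set a₁ := Real.log s with ha₁
  have hexp : Real.exp (4 * a₁) = n := by
    rw [ha₁, show (4 : ℝ) * Real.log s = ((4 : ℕ) : ℝ) * Real.log s by norm_num, Real.exp_nat_mul,
      Real.exp_log hs0, hs4]
  have ha₁ge : (d : ℝ) + 5 / 2 ≤ a₁ := by
    have h1 : Real.log ((10 : ℝ) ^ (2 * d + 5)) ≤ Real.log n := Real.log_le_log (by positivity) hn
    rw [Real.log_pow] at h1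
    have h2 : 4 * a₁ = Real.log n := by
      rw [← hexp, Real.log_exp]
    have h3 : ((2 * d + 5 : ℕ) : ℝ) * 2 ≤ ((2 * d + 5 : ℕ) : ℝ) * Real.log 10 :=
      mul_le_mul_of_nonneg_left two_le_log_ten (by positivity)
    push_cast at h1 h3
    linarith
  have ha₁s : a₁ ≤ s - 1 := Real.log_le_sub_one_of_pos hs0
  have hlo : (d : ℝ) + 1 ≤ a₁ := by linarith
  -- `y(d+1) < y`
  have hylo : xiGaussY n ((d : ℝ) + 1) < y := by
    have h := xiGaussY_le n (by linarith : (0 : ℝ) < d + 1)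
    -- `4π(d+1)e^{4(d+1)} ≤ 13(d+1)·55^{d+1} ≤ 10^{2d+5} ≤ n`
    have he : Real.exp (4 * ((d : ℝ) + 1)) ≤ 55 ^ (d + 1) := by
      rw [show 4 * ((d : ℝ) + 1) = ((d + 1 : ℕ) : ℝ) * 4 by push_cast; ring, Real.exp_nat_mul]
      exact pow_le_pow_left₀ (Real.exp_pos 4).le exp_four_le _
    have hπ : π ≤ 13 / 4 := by have := Real.pi_lt_d2; linarith
    have hB : 1 + (d : ℝ) * (9 / 11) ≤ (20 / 11) ^ d := by
      have := one_add_mul_le_pow (by norm_num : (-2 : ℝ) ≤ 9 / 11) d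
      norm_num at this ⊢; linarith
    have h100 : (100 : ℝ) ^ d = 55 ^ d * (20 / 11) ^ d := by rw [← mul_pow]; norm_num
    have h10 : (10 : ℝ) ^ (2 * d + 5) = 100000 * 100 ^ d := by
      rw [pow_add, pow_mul, mul_comm]; norm_num
    have h55 : (0 : ℝ) < 55 ^ d := by positivity
    have key : 13 * ((d : ℝ) + 1) * 55 ^ (d + 1) ≤ (10 : ℝ) ^ (2 * d + 5) := by
      rw [h10, h100, pow_succ]
      have : 13 * ((d : ℝ) + 1) * 55 ≤ 100000 * (1 + (d : ℝ) * (9 / 11)) := by nlinarith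
      nlinarith [mul_le_mul_of_nonneg_left hB h55.le]
    have h4 : 4 * π * Real.exp (4 * ((d : ℝ) + 1)) ≤ 13 * 55 ^ (d + 1) := by
      have := mul_le_mul (by linarith : 4 * π ≤ 13) he (Real.exp_pos _).le (by norm_num)
      linarith
    have h5 : ((d : ℝ) + 1) * (4 * π * Real.exp (4 * ((d : ℝ) + 1)) - 9) ≤
        13 * ((d : ℝ) + 1) * 55 ^ (d + 1) := by nlinarith
    linarith
  -- `y ≤ y(a₁)`
  have hyhi : y ≤ xiGaussY n a₁ := by
    have h := le_xiGaussY n (by linarith : (3 : ℝ) / 2 ≤ a₁)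
    rw [hexp] at h
    have : (7 : ℝ) / 2 * (4 * π * n - 9.005) - n ≤ a₁ * (4 * π * n - 9.005) - n := by
      have hpos : 0 ≤ 4 * π * (n : ℝ) - 9.005 := by nlinarith [Real.pi_gt_three, hn1]
      nlinarith
    nlinarith [Real.pi_gt_three, hn1]
  -- intermediate value theorem on `[d+1, a₁]`
  have hcont : ContinuousOn (xiGaussY n) (Icc ((d : ℝ) + 1) a₁) := (continuous_xiGaussY n).continuousOn
  obtain ⟨a, ha, hay⟩ := intermediate_value_Icc hlo hcont ⟨hylo.le, hyhi⟩
  exact ⟨a, ha.1, ha.2.trans ha₁s, hay⟩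

/-! ### Monotonicity of `x(a) = y(a)/a² = L(a)/a - n/a²` -/

/-- `a ↦ L(a)/a` is strictly increasing on `[1, ∞)`: its derivative `(aV(a) - L(a))/a²` is positive
since `aV(a) > 16πae^{4a} ≥ a(4L(a) + 36) > L(a)`. [cite: CoffeyCsordas2013, Theorem 2.4 (proof)] -/
theorem strictMonoOn_phiNegLogDeriv_div : StrictMonoOn (fun a : ℝ => phiNegLogDeriv a / a) (Ici 1) := by
  have hder : ∀ a : ℝ, 0 < a → HasDerivAt (fun a : ℝ => phiNegLogDeriv a / a)
      ((phiNegLogDeriv₂ a * a - phiNegLogDeriv a * 1) / a ^ 2) a := fun a ha =>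
    (hasDerivAt_phiNegLogDeriv a).div (hasDerivAt_id a) ha.ne'
  refine strictMonoOn_of_deriv_pos (convex_Ici 1)
    (fun a ha => (hder a (lt_of_lt_of_le one_pos ha)).continuousAt.continuousWithinAt) ?_
  intro a ha
  rw [interior_Ici] at ha
  have ha0 : 0 < a := lt_trans one_pos ha
  rw [(hder a ha0).deriv]
  apply div_pos _ (pow_pos ha0 2)
  have hV := phiNegLogDeriv₂_gt a
  rw [abs_of_pos ha0] at hV
  have hL : phiNegLogDeriv a ≤ 4 * π * Real.exp (4 * a) - 9 := by
    unfold phiNegLogDeriv; exact neg_deBruijnPhiDeriv_div_le ha0.le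
  have hE : 0 ≤ 16 * π * Real.exp (4 * a) := by positivity
  have h1 : 16 * π * Real.exp (4 * a) * 1 ≤ 16 * π * Real.exp (4 * a) * a :=
    mul_le_mul_of_nonneg_left ha.le hE
  have h2 : 16 * π * Real.exp (4 * a) * a < phiNegLogDeriv₂ a * a := mul_lt_mul_of_pos_right hV ha0
  linarith

/-- **`x(a) = y(a)/a²` is strictly increasing on `[1, ∞)`.** [cite: CoffeyCsordas2013, Theorem 2.4 (proof)] -/
theorem xiGaussX_strictMonoOn (n : ℕ) : StrictMonoOn (xiGaussX n) (Ici 1) := by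
  intro a ha b hb hab
  have ha0 : 0 < a := lt_of_lt_of_le one_pos ha
  have hb0 : 0 < b := lt_of_lt_of_le one_pos hb
  have h1 := strictMonoOn_phiNegLogDeriv_div ha hb hab
  have h2 : (n : ℝ) / b ^ 2 ≤ n / a ^ 2 :=
    div_le_div_of_nonneg_left (Nat.cast_nonneg n) (pow_pos ha0 2) (pow_le_pow_left₀ ha0.le hab.le 2)
  have ea : xiGaussX n a = phiNegLogDeriv a / a - n / a ^ 2 := by
    unfold xiGaussX xiGaussY; field_simp
  have eb : xiGaussX n b = phiNegLogDeriv b / b - n / b ^ 2 := by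
    unfold xiGaussX xiGaussY; field_simp
  rw [ea, eb]
  linarith

end Literature.NumberTheory.LFunctions
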